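import Literature.Computability.AlgebraicComplexity.BILPS19LatinRectangleConditionProofs
import HarnessLib

/-!
# BILPS 2019 Thm 27 (equations for the minrank varieties `𝓜_r`): the slice `k = dim U = 2`

Bläser–Ikenmeyer–Lysikov–Pandey–Schreyer 2019, Thm. 27 (held text `paper:arxiv-1911.02534`
p0026:L36; tree fact `BILPS2019_thm27`, typed WEAKER as: for `m ≤ n`, `m, n > kr` and `LRC(k, m)`
there is a nonzero equation of `𝓜_r ⊆ U ⊗ V ⊗ W`, homogeneous of degree `k·m`). This file proves the
slice `k = 2` (`BILPS2019_thm27_of_k_eq_two`), NOT by the printed highest-weight-vector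
construction but by classical invariant theory of binary forms:

* a tensor `T ∈ F^{2 × m × n}` is a pencil of two `m × n` matrices; truncating to the first `m`
  columns, `p_T(s) = det(s·T₀ + T₁)` is (the dehomogenisation of) a binary form of degree `m`;
* `T ∈ 𝓜_r` gives `(x₀, x₁) ≠ 0` with `rk(x₀T₀ + x₁T₁) ≤ r`, hence `p_T` has a root of multiplicity
  `≥ m - r > m/2` at `s = x₀/x₁` (`X_pow_dvd_det_X_smul_add_of_rank_le`: `det(sB + N)` is divisible
  by `s^{m-r}` when `rk N ≤ r`, via transvection diagonalisation and the Leibniz formula) — or, if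
  `x₁ = 0`, degree `≤ r < m/2` (`natDegree_det_X_smul_add_le_of_rank_le`);
* the **apolar (degree-two) invariant** `A_m(p) = ∑_i (-1)^i (m-i)! i! · p_{m-i} p_i` of a binary
  form of EVEN degree `m` (`LRC(2, m)` holds exactly for even `m`, sibling file
  `BILPS19LatinRectangleConditionProofs.lean`) vanishes on forms with a root of multiplicity `> m/2`:
  `A_m(p) = W(p,p)(0)` for `W(p,q) = ∑_i (-1)^i p^{(m-i)} q^{(i)}`, whose derivative telescopes to `0`
  (`derivative_apolarW`), so `W` is constant (char `0`) and may be evaluated at the root, where every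
  term has a vanishing factor;
* pulled back along `T ↦ p_T`, `A_m` is a polynomial in the tensor entries, homogeneous of degree
  `2m`, vanishing on `𝓜_r`, and nonzero at the diagonal pencil `s·diag(1^h 0^h) + diag(0^h 1^h)`
  (`p = s^h`, `A_m = (-1)^h (h!)²`).

Theorem-only apart from private plumbing; no named facts; nothing here bears on `VP ≠ VNP`
(a PARTIAL, by theorem, of an XL typed fact of row X5-BILPS19).

## References
* [BlaserIkenmeyerLysikovPandeySchreyer2019] arXiv:1911.02534, §7.3 Thm. 27 (p0026:L36), Def. 15.
* (method) classical apolarity for binary forms, e.g. J. P. S. Kung, G.-C. Rota, *The invariant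
  theory of binary forms*, Bull. AMS 10 (1984), §2–3 — used only as a guide; everything is proved here.
-/

noncomputable section

open Finset

namespace Literature.Computability.AlgebraicComplexity

namespace BILPS2019

/-! ## A. The apolar pairing of two polynomials of degree `≤ m` -/

section Apolar

variable {F : Type*} [Field F]

/-- `W_m(p, q) = ∑_{i ≤ m} (-1)^i · p^{(m-i)} · q^{(i)}`. [folklore] -/
private def apolarW (m : ℕ) (p q : Polynomial F) : Polynomial F :=
  ∑ i ∈ range (m + 1), ((-1 : F) ^ i) • (Polynomial.derivative^[m - i] p * Polynomial.derivative^[i] q)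

/-- The derivative of `W_m(p, q)` telescopes to `p^{(m+1)} q ± p q^{(m+1)} = 0` for
`deg p, deg q ≤ m`. [folklore] -/
private theorem derivative_apolarW {m : ℕ} {p q : Polynomial F} (hp : p.natDegree ≤ m)
    (hq : q.natDegree ≤ m) : Polynomial.derivative (apolarW m p q) = 0 := by
  set S : ℕ → Polynomial F := fun i =>
    ((-1 : F) ^ i) • (Polynomial.derivative^[m + 1 - i] p * Polynomial.derivative^[i] q) with hS
  have hstep : ∀ i ∈ range (m + 1),
      Polynomial.derivative (((-1 : F) ^ i) •
        (Polynomial.derivative^[m - i] p * Polynomial.derivative^[i] q)) = S i - S (i + 1) := by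
    intro i hi
    rw [Finset.mem_range] at hi
    rw [Polynomial.derivative_smul, Polynomial.derivative_mul, hS]
    simp only
    rw [show m + 1 - i = (m - i) + 1 by omega, show m + 1 - (i + 1) = m - i by omega,
      Function.iterate_succ_apply', Function.iterate_succ_apply', pow_succ]
    rw [smul_add, mul_neg_one, neg_smul, sub_neg_eq_add]
  unfold apolarW
  rw [Polynomial.derivative_sum, Finset.sum_congr rfl hstep, Finset.sum_range_sub', hS]
  simp only
  rw [Nat.sub_zero, Nat.sub_self, Function.iterate_zero_apply,
    Polynomial.iterate_derivative_eq_zero (Nat.lt_succ_of_le hp),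
    Polynomial.iterate_derivative_eq_zero (Nat.lt_succ_of_le hq)]
  simp

/-- Hence `W_m(p, q)` is constant (characteristic zero). [folklore] -/
private theorem eval_apolarW_eq [CharZero F] {m : ℕ} {p q : Polynomial F} (hp : p.natDegree ≤ m)
    (hq : q.natDegree ≤ m) (a : F) : (apolarW m p q).eval a = (apolarW m p q).eval 0 := by
  rw [Polynomial.eq_C_of_derivative_eq_zero (derivative_apolarW hp hq), Polynomial.eval_C,
    Polynomial.eval_C]

/-- Iterated derivatives commute with the translation `X ↦ X + a`. [folklore] -/
private theorem iterate_derivative_comp_X_add_C (p : Polynomial F) (a : F) (k : ℕ) :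
    Polynomial.derivative^[k] (p.comp (Polynomial.X + Polynomial.C a)) =
      (Polynomial.derivative^[k] p).comp (Polynomial.X + Polynomial.C a) := by
  induction k with
  | zero => rfl
  | succ k ih =>
    rw [Function.iterate_succ_apply', Function.iterate_succ_apply', ih, Polynomial.derivative_comp]
    simp

/-- Translation: `W_m(p,q)(a) = W_m(p(X+a), q(X+a))(0)`. [folklore] -/
private theorem eval_apolarW_comp (m : ℕ) (p q : Polynomial F) (a : F) :
    (apolarW m (p.comp (Polynomial.X + Polynomial.C a)) (q.comp (Polynomial.X + Polynomial.C a))).eval 0 =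
      (apolarW m p q).eval a := by
  unfold apolarW
  rw [Polynomial.eval_finsetSum, Polynomial.eval_finsetSum]
  refine Finset.sum_congr rfl fun i _ => ?_
  rw [Polynomial.eval_smul, Polynomial.eval_smul, Polynomial.eval_mul, Polynomial.eval_mul,
    iterate_derivative_comp_X_add_C, iterate_derivative_comp_X_add_C, Polynomial.eval_comp,
    Polynomial.eval_comp]
  simp

/-- The value at `0` of an iterated derivative is a factorial multiple of a coefficient. [folklore] -/
private theorem eval_zero_iterate_derivative (p : Polynomial F) (k : ℕ) :
    (Polynomial.derivative^[k] p).eval 0 = (k.factorial : F) * p.coeff k := by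
  rw [← Polynomial.coeff_zero_eq_eval_zero, Polynomial.coeff_iterate_derivative, zero_add,
    Nat.descFactorial_self, nsmul_eq_mul]

/-- **`A_m(p, q) := W_m(p,q)(0) = ∑_i (-1)^i (m-i)! i! · p_{m-i} q_i`** in coefficients. [folklore] -/
private theorem eval_zero_apolarW (m : ℕ) (p q : Polynomial F) :
    (apolarW m p q).eval 0 =
      ∑ i ∈ range (m + 1), ((-1 : F) ^ i * ((m - i).factorial * i.factorial : ℕ)) *
        (p.coeff (m - i) * q.coeff i) := by
  unfold apolarW
  rw [Polynomial.eval_finsetSum]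
  refine Finset.sum_congr rfl fun i _ => ?_
  rw [Polynomial.eval_smul, Polynomial.eval_mul, eval_zero_iterate_derivative,
    eval_zero_iterate_derivative, smul_eq_mul]
  push_cast
  ring

/-- **Vanishing at a deep root**: if `X^j ∣ p(X + a)` with `2j > m ≥ deg p` then `A_m(p, p) = 0`
(translate to the root; every term `p̃^{(m-i)}(0) p̃^{(i)}(0)` has `i < j` or `m - i < j`).
[folklore] -/
private theorem eval_zero_apolarW_eq_zero_of_dvd [CharZero F] {m j : ℕ} {p : Polynomial F}
    (hp : p.natDegree ≤ m) (a : F)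
    (hdvd : Polynomial.X ^ j ∣ p.comp (Polynomial.X + Polynomial.C a)) (hj : m < 2 * j) :
    (apolarW m p p).eval 0 = 0 := by
  rw [← eval_apolarW_eq hp hp a, ← eval_apolarW_comp]
  set q := p.comp (Polynomial.X + Polynomial.C a) with hq
  rw [Polynomial.X_pow_dvd_iff] at hdvd
  unfold apolarW
  rw [Polynomial.eval_finsetSum]
  refine Finset.sum_eq_zero fun i hi => ?_
  rw [Finset.mem_range] at hi
  rw [Polynomial.eval_smul, Polynomial.eval_mul, eval_zero_iterate_derivative,
    eval_zero_iterate_derivative]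
  rcases Nat.lt_or_ge i j with h | h
  · rw [hdvd i h]; simp
  · rw [hdvd (m - i) (by omega)]; simp

/-- **Vanishing for low degree**: if `deg p ≤ r` with `2r < m` then `A_m(p, p) = 0`. [folklore] -/
private theorem eval_zero_apolarW_eq_zero_of_natDegree_le {m r : ℕ} {p : Polynomial F}
    (hp : p.natDegree ≤ r) (hr : 2 * r < m) : (apolarW m p p).eval 0 = 0 := by
  rw [eval_zero_apolarW]
  refine Finset.sum_eq_zero fun i hi => ?_
  rw [Finset.mem_range] at hi
  rcases Nat.lt_or_ge r i with h | h
  · rw [Polynomial.coeff_eq_zero_of_natDegree_lt (hp.trans_lt h)]; simp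
  · rw [Polynomial.coeff_eq_zero_of_natDegree_lt (n := m - i) (hp.trans_lt (by omega))]; simp

end Apolar

/-! ## B. `det(s·B + N)` for `rk N ≤ r`: divisible by `s^{m-r}`; `det(s·N + B)` has degree `≤ r` -/

section DetRank

variable {F : Type*} [Field F] {ι : Type*} [Fintype ι] [DecidableEq ι]

/-- Diagonal core, divisibility: if every set of indices on which `w ≠ 0` has `≤ r` elements then
`X^{|ι| - r} ∣ det(X·B + diag w)` (Leibniz: in every permutation term the factors off the support of
`w` are multiples of `X`). [folklore] -/
private theorem X_pow_dvd_det_diagonal (w : ι → F) (B : Matrix ι ι F) {r : ℕ}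
    (hw : ∀ s : Finset ι, (∀ i ∈ s, w i ≠ 0) → s.card ≤ r) :
    (Polynomial.X : Polynomial F) ^ (Fintype.card ι - r) ∣
      Matrix.det ((Polynomial.X : Polynomial F) • B.map Polynomial.C +
        (Matrix.diagonal w).map Polynomial.C) := by
  classical
  rw [Matrix.det_apply']
  refine Finset.dvd_sum fun σ _ => Dvd.dvd.mul_left ?_ _
  set Z : Finset ι := univ.filter fun i => Matrix.diagonal w (σ i) i = 0 with hZ
  have hZc : (Zᶜ).card ≤ r := by
    refine hw _ fun i hi => ?_
    rw [Finset.mem_compl, hZ, Finset.mem_filter, not_and] at hi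
    have h := hi (Finset.mem_univ i)
    intro h0
    refine h ?_
    by_cases hσ : σ i = i
    · rw [hσ, Matrix.diagonal_apply_eq, h0]
    · rw [Matrix.diagonal_apply_ne _ hσ]
  have hZcard : Fintype.card ι - r ≤ Z.card := by
    have := Finset.card_add_card_compl Z
    omega
  rw [← Finset.prod_mul_prod_compl Z]
  refine Dvd.dvd.mul_right ?_ _
  have hprod : ∏ i ∈ Z, ((Polynomial.X : Polynomial F) • B.map Polynomial.C +
      (Matrix.diagonal w).map Polynomial.C) (σ i) i =
        Polynomial.X ^ Z.card * ∏ i ∈ Z, Polynomial.C (B (σ i) i) := by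
    rw [← Finset.prod_const, ← Finset.prod_mul_distrib]
    refine Finset.prod_congr rfl fun i hi => ?_
    rw [hZ, Finset.mem_filter] at hi
    rw [Matrix.add_apply, Matrix.smul_apply, Matrix.map_apply, Matrix.map_apply, hi.2, map_zero,
      add_zero, smul_eq_mul]
  rw [hprod]
  exact Dvd.dvd.mul_right (pow_dvd_pow _ hZcard) _

/-- Diagonal core, degree: under the same hypothesis `deg det(X·diag w + B) ≤ r`. [folklore] -/
private theorem natDegree_det_diagonal_le (w : ι → F) (B : Matrix ι ι F) {r : ℕ}
    (hw : ∀ s : Finset ι, (∀ i ∈ s, w i ≠ 0) → s.card ≤ r) :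
    (Matrix.det ((Polynomial.X : Polynomial F) • (Matrix.diagonal w).map Polynomial.C +
        B.map Polynomial.C)).natDegree ≤ r := by
  classical
  rw [Matrix.det_apply']
  refine Polynomial.natDegree_sum_le_of_forall_le _ _ fun σ _ => ?_
  refine (Polynomial.natDegree_mul_le).trans ?_
  rw [Polynomial.natDegree_intCast, zero_add]
  refine (Polynomial.natDegree_prod_le _ _).trans ?_
  set Z : Finset ι := univ.filter fun i => Matrix.diagonal w (σ i) i = 0 with hZ
  have hZc : (Zᶜ).card ≤ r := by
    refine hw _ fun i hi => ?_
    rw [Finset.mem_compl, hZ, Finset.mem_filter, not_and] at hi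
    have h := hi (Finset.mem_univ i)
    intro h0
    refine h ?_
    by_cases hσ : σ i = i
    · rw [hσ, Matrix.diagonal_apply_eq, h0]
    · rw [Matrix.diagonal_apply_ne _ hσ]
  rw [← Finset.sum_add_sum_compl Z]
  have h0 : ∑ i ∈ Z, (((Polynomial.X : Polynomial F) • (Matrix.diagonal w).map Polynomial.C +
      B.map Polynomial.C) (σ i) i).natDegree = 0 := by
    refine Finset.sum_eq_zero fun i hi => ?_
    rw [hZ, Finset.mem_filter] at hi
    rw [Matrix.add_apply, Matrix.smul_apply, Matrix.map_apply, Matrix.map_apply, hi.2, map_zero,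
      smul_zero, zero_add, Polynomial.natDegree_C]
  rw [h0, zero_add]
  refine le_trans (Finset.sum_le_card_nsmul _ _ 1 fun i _ => ?_) (by simpa using hZc)
  rw [Matrix.add_apply, Matrix.smul_apply, Matrix.map_apply, Matrix.map_apply, smul_eq_mul]
  refine (Polynomial.natDegree_add_le _ _).trans (max_le ?_ ?_)
  · exact (Polynomial.natDegree_mul_le).trans (by
      rw [Polynomial.natDegree_X, Polynomial.natDegree_C])
  · rw [Polynomial.natDegree_C]; exact Nat.zero_le _

/-- Transvection diagonalisation transported to the polynomial pencils. [folklore] -/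
private theorem exists_diagonal_conj (N B : Matrix ι ι F) {r : ℕ} (hN : N.rank ≤ r) :
    ∃ (w : ι → F) (B' : Matrix ι ι F), (∀ s : Finset ι, (∀ i ∈ s, w i ≠ 0) → s.card ≤ r) ∧
      Matrix.det ((Polynomial.X : Polynomial F) • B.map Polynomial.C + N.map Polynomial.C) =
        Matrix.det ((Polynomial.X : Polynomial F) • B'.map Polynomial.C +
          (Matrix.diagonal w).map Polynomial.C) ∧
      Matrix.det ((Polynomial.X : Polynomial F) • N.map Polynomial.C + B.map Polynomial.C) =
        Matrix.det ((Polynomial.X : Polynomial F) • (Matrix.diagonal w).map Polynomial.C +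
          B'.map Polynomial.C) := by
  classical
  obtain ⟨L, L', w, hLDL⟩ := Matrix.Pivot.exists_list_transvec_mul_diagonal_mul_list_transvec N
  set P : Matrix ι ι F := (L.map Matrix.TransvectionStruct.toMatrix).prod with hP
  set Q : Matrix ι ι F := (L'.map Matrix.TransvectionStruct.toMatrix).prod with hQ
  have hPdet : P.det = 1 := Matrix.TransvectionStruct.det_toMatrix_prod L
  have hQdet : Q.det = 1 := Matrix.TransvectionStruct.det_toMatrix_prod L'
  have hPu : IsUnit P.det := by rw [hPdet]; exact isUnit_one
  have hQu : IsUnit Q.det := by rw [hQdet]; exact isUnit_one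
  set B' : Matrix ι ι F := P⁻¹ * B * Q⁻¹ with hB'
  have hBconj : P * B' * Q = B := by
    rw [hB', ← Matrix.mul_assoc, ← Matrix.mul_assoc, Matrix.mul_nonsing_inv _ hPu, Matrix.one_mul,
      Matrix.mul_assoc, Matrix.nonsing_inv_mul _ hQu, Matrix.mul_one]
  -- rank of the diagonal part
  have hrank : (Matrix.diagonal w).rank = N.rank := by
    rw [hLDL, Matrix.rank_mul_eq_left_of_isUnit_det _ _ hQu,
      Matrix.rank_mul_eq_right_of_isUnit_det _ _ hPu]
  have hw : ∀ s : Finset ι, (∀ i ∈ s, w i ≠ 0) → s.card ≤ r := by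
    intro s hs
    have h := Matrix.rank_diagonal w
    rw [Fintype.card_subtype] at h
    calc s.card ≤ (univ.filter fun i => w i ≠ 0).card :=
          Finset.card_le_card fun i hi => Finset.mem_filter.mpr ⟨Finset.mem_univ i, hs i hi⟩
      _ = N.rank := by rw [← h, hrank]
      _ ≤ r := hN
  have hdetP : (P.map (Polynomial.C : F →+* Polynomial F)).det = 1 := by
    rw [← RingHom.mapMatrix_apply, ← RingHom.map_det, hPdet, map_one]
  have hdetQ : (Q.map (Polynomial.C : F →+* Polynomial F)).det = 1 := by
    rw [← RingHom.mapMatrix_apply, ← RingHom.map_det, hQdet, map_one]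
  refine ⟨w, B', hw, ?_, ?_⟩
  · have hmat : (Polynomial.X : Polynomial F) • B.map Polynomial.C + N.map Polynomial.C =
        P.map Polynomial.C * ((Polynomial.X : Polynomial F) • B'.map Polynomial.C +
          (Matrix.diagonal w).map Polynomial.C) * Q.map Polynomial.C := by
      rw [Matrix.mul_add, Matrix.add_mul, Matrix.mul_smul, Matrix.smul_mul, ← Matrix.map_mul,
        ← Matrix.map_mul, ← Matrix.map_mul, ← Matrix.map_mul, hBconj, ← hLDL]
    rw [hmat, Matrix.det_mul, Matrix.det_mul, hdetP, hdetQ, mul_one, one_mul]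
  · have hmat : (Polynomial.X : Polynomial F) • N.map Polynomial.C + B.map Polynomial.C =
        P.map Polynomial.C * ((Polynomial.X : Polynomial F) • (Matrix.diagonal w).map Polynomial.C +
          B'.map Polynomial.C) * Q.map Polynomial.C := by
      rw [Matrix.mul_add, Matrix.add_mul, Matrix.mul_smul, Matrix.smul_mul, ← Matrix.map_mul,
        ← Matrix.map_mul, ← Matrix.map_mul, ← Matrix.map_mul, hBconj, ← hLDL]
    rw [hmat, Matrix.det_mul, Matrix.det_mul, hdetP, hdetQ, mul_one, one_mul]

/-- **`rk N ≤ r ⇒ X^{|ι|-r} ∣ det(X·B + N)`** — the pencil `sB + N` has a root of multiplicity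
`≥ |ι| - r` at `s = 0`. [folklore] -/
private theorem X_pow_dvd_det_X_smul_add_of_rank_le (N B : Matrix ι ι F) {r : ℕ} (hN : N.rank ≤ r) :
    (Polynomial.X : Polynomial F) ^ (Fintype.card ι - r) ∣
      Matrix.det ((Polynomial.X : Polynomial F) • B.map Polynomial.C + N.map Polynomial.C) := by
  obtain ⟨w, B', hw, h1, -⟩ := exists_diagonal_conj N B hN
  rw [h1]
  exact X_pow_dvd_det_diagonal w B' hw

/-- **`rk N ≤ r ⇒ deg det(X·N + B) ≤ r`.** [folklore] -/
private theorem natDegree_det_X_smul_add_le_of_rank_le (N B : Matrix ι ι F) {r : ℕ} (hN : N.rank ≤ r) :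
    (Matrix.det ((Polynomial.X : Polynomial F) • N.map Polynomial.C + B.map Polynomial.C)).natDegree
      ≤ r := by
  obtain ⟨w, B', hw, -, h2⟩ := exists_diagonal_conj N B hN
  rw [h2]
  exact natDegree_det_diagonal_le w B' hw

end DetRank

/-! ## C. Coefficients of a determinant with homogeneous linear entries are homogeneous -/

section Homog

variable {F : Type*} [Field F] {τ : Type*}

/-- Coefficientwise homogeneity is multiplicative over finite products. [folklore] -/
private theorem coeff_prod_isHomogeneous {ι' : Type*} (s : Finset ι')
    (g : ι' → Polynomial (MvPolynomial τ F)) (d : ι' → ℕ)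
    (h : ∀ i ∈ s, ∀ k, ((g i).coeff k).IsHomogeneous (d i)) :
    ∀ k, ((∏ i ∈ s, g i).coeff k).IsHomogeneous (∑ i ∈ s, d i) := by
  induction s using Finset.cons_induction with
  | empty =>
    intro k
    rw [Finset.prod_empty, Finset.sum_empty, Polynomial.coeff_one]
    split_ifs
    · exact MvPolynomial.isHomogeneous_one _ _
    · exact MvPolynomial.isHomogeneous_zero _ _ _
  | cons a s ha ih =>
    intro k
    rw [Finset.prod_cons, Finset.sum_cons, Polynomial.coeff_mul]
    refine MvPolynomial.IsHomogeneous.sum _ _ _ fun x _ => ?_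
    exact (h a (Finset.mem_cons_self a s) x.1).mul
      (ih (fun i hi => h i (Finset.mem_cons_of_mem hi)) x.2)

/-- If every coefficient of every entry of `M` is homogeneous of degree `1`, every coefficient of
`det M` is homogeneous of degree the size of `M`. [folklore] -/
private theorem coeff_det_isHomogeneous {ι : Type*} [Fintype ι] [DecidableEq ι]
    (M : Matrix ι ι (Polynomial (MvPolynomial τ F)))
    (hM : ∀ i j k, ((M i j).coeff k).IsHomogeneous 1) (k : ℕ) :
    ((M.det).coeff k).IsHomogeneous (Fintype.card ι) := by
  rw [Matrix.det_apply', Polynomial.finsetSum_coeff]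
  refine MvPolynomial.IsHomogeneous.sum _ _ _ fun σ _ => ?_
  rw [← map_intCast (Polynomial.C : MvPolynomial τ F →+* _), Polynomial.coeff_C_mul]
  have h := coeff_prod_isHomogeneous (Finset.univ : Finset ι) (fun i => M (σ i) i) (fun _ => 1)
    (fun i _ k => hM (σ i) i k) k
  rw [Finset.sum_const, Finset.card_univ, smul_eq_mul, mul_one] at h
  have hc : (((Equiv.Perm.sign σ : ℤ) : MvPolynomial τ F)).IsHomogeneous 0 := by
    rw [← map_intCast (MvPolynomial.C : F →+* MvPolynomial τ F)]
    exact MvPolynomial.isHomogeneous_C _ _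
  have := hc.mul h
  rwa [zero_add] at this

end Homog

/-! ## D. Thm 27 for `k = 2` -/

section RankTwo

variable {F : Type*} [Field F]

/-- Scalar multiples do not increase the rank. [folklore] -/
private theorem rank_smul_le {m : ℕ} (c : F) (M : Matrix (Fin m) (Fin m) F) :
    (c • M).rank ≤ M.rank := by
  rw [Matrix.smul_eq_diagonal_mul]
  exact Matrix.rank_mul_le_right _ _

/-- Translating the pencil polynomial: `det(X·N₀ + N₁)(X + a) = det(X·N₀ + (a N₀ + N₁))`.
[folklore] -/
private theorem det_pencil_comp {m : ℕ} (N₀ N₁ : Matrix (Fin m) (Fin m) F) (a : F) :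
    (Matrix.det ((Polynomial.X : Polynomial F) • N₀.map Polynomial.C + N₁.map Polynomial.C)).comp
        (Polynomial.X + Polynomial.C a) =
      Matrix.det ((Polynomial.X : Polynomial F) • N₀.map Polynomial.C +
        (a • N₀ + N₁).map Polynomial.C) := by
  rw [← Polynomial.coe_compRingHom_apply, RingHom.map_det]
  congr 1
  ext i j
  simp only [RingHom.mapMatrix_apply, Matrix.map_apply, Matrix.add_apply, Matrix.smul_apply,
    smul_eq_mul, Polynomial.coe_compRingHom_apply, Polynomial.X_comp, Polynomial.C_comp, map_add,
    map_mul]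
  ring

/-- **BILPS Thm 27 for `k = dim U = 2`** (typed form): for `m ≤ n`, `2r < m`, `2r < n` and
`LRC(2, m)` (i.e. `m` even) there is a nonzero equation of `𝓜_r ⊆ F^{2 × m × n}`, homogeneous of
degree `2m` — the apolar invariant of the binary form `det(s T₀ + t T₁)` of the truncated pencil.
(The source obtains its degree-`km` equations from highest weight vectors of type
`((k×m),(m×k),(m×k))`; that construction is not followed here.)
[cite: BlaserIkenmeyerLysikovPandeySchreyer2019, Thm. 27 (case k = 2)] -/
theorem BILPS2019_thm27_of_k_eq_two (F : Type) [Field F] [IsAlgClosed F] [CharZero F] (m n r : ℕ)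
    (hmn : m ≤ n) (hm : 2 * r < m) (_hn : 2 * r < n) (hL : latinRectangleCondition 2 m) :
    ∃ f : MvPolynomial (Fin 2 × Fin m × Fin n) F, f ≠ 0 ∧ f.IsHomogeneous (2 * m) ∧
      ∀ T ∈ (minrankSet F r : Set (Fin 2 → Fin m → Fin n → F)),
        MvPolynomial.eval (trilinearPt T) f = 0 := by
  classical
  obtain ⟨h, rfl⟩ := (latinRectangleCondition_two_iff m).mp hL
  -- column truncation to a square pencil
  obtain ⟨ρ, hρ⟩ : ∃ ρ : Fin (h + h) → Fin n, ∀ j, (ρ j : ℕ) = j := ⟨Fin.castLE hmn, fun _ => rfl⟩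
  -- the evaluated pencil of a tensor and its pencil polynomial `p_T(s) = det(s T₀ + T₁)`
  set N : (Fin 2 → Fin (h + h) → Fin n → F) → Fin 2 → Matrix (Fin (h + h)) (Fin (h + h)) F :=
    fun T a => Matrix.of fun i j => T a i (ρ j) with hN
  set pT : (Fin 2 → Fin (h + h) → Fin n → F) → Polynomial F := fun T =>
    Matrix.det ((Polynomial.X : Polynomial F) • (N T 0).map Polynomial.C + (N T 1).map Polynomial.C)
    with hpT
  -- the generic pencil and its pencil polynomial
  set M : Matrix (Fin (h + h)) (Fin (h + h)) (Polynomial (MvPolynomial (Fin 2 × Fin (h + h) × Fin n) F)) :=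
    (Polynomial.X : Polynomial (MvPolynomial (Fin 2 × Fin (h + h) × Fin n) F)) •
        (Matrix.of fun i j => MvPolynomial.X ((0 : Fin 2), i, ρ j)).map Polynomial.C +
      (Matrix.of fun i j => MvPolynomial.X ((1 : Fin 2), i, ρ j)).map Polynomial.C with hM
  set P : Polynomial (MvPolynomial (Fin 2 × Fin (h + h) × Fin n) F) := M.det with hP
  -- the apolar invariant of the generic pencil polynomial
  set f : MvPolynomial (Fin 2 × Fin (h + h) × Fin n) F :=
    ∑ i ∈ range (h + h + 1), MvPolynomial.C ((-1 : F) ^ i * ((h + h - i).factorial * i.factorial : ℕ)) *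
      (P.coeff (h + h - i) * P.coeff i) with hf
  -- (1) evaluation at a tensor
  have hmap : ∀ T : Fin 2 → Fin (h + h) → Fin n → F,
      P.map (MvPolynomial.eval (trilinearPt T)) = pT T := by
    intro T
    rw [hP, ← Polynomial.coe_mapRingHom, RingHom.map_det]
    congr 1
    ext i j
    simp [hM, hN, RingHom.mapMatrix_apply, Matrix.map_apply, Matrix.add_apply, Matrix.smul_apply,
      trilinearPt, Polynomial.map_mul, Polynomial.map_add]
  have heval : ∀ T : Fin 2 → Fin (h + h) → Fin n → F,
      MvPolynomial.eval (trilinearPt T) f = (apolarW (h + h) (pT T) (pT T)).eval 0 := by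
    intro T
    rw [eval_zero_apolarW, hf, map_sum]
    refine Finset.sum_congr rfl fun i _ => ?_
    rw [map_mul, MvPolynomial.eval_C, map_mul, ← Polynomial.coeff_map, ← Polynomial.coeff_map, hmap]
  have hdeg : ∀ T : Fin 2 → Fin (h + h) → Fin n → F, (pT T).natDegree ≤ h + h := fun T => by
    simpa using Polynomial.natDegree_det_X_add_C_le (N T 0) (N T 1)
  refine ⟨f, ?_, ?_, ?_⟩
  · -- (2) nonzero: the diagonal pencil `s·diag(1^h 0^h) + diag(0^h 1^h)` has `p = s^h`
    set d : Fin 2 → Fin (h + h) → F := ![fun i => if (i : ℕ) < h then 1 else 0,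
      fun i => if (i : ℕ) < h then 0 else 1] with hd
    set Ts : Fin 2 → Fin (h + h) → Fin n → F := fun a i j => if (j : ℕ) = i then d a i else 0 with hTs
    have hNT : ∀ a, N Ts a = Matrix.diagonal (d a) := by
      intro a
      ext i j
      simp only [hN, hTs, Matrix.of_apply, hρ, Matrix.diagonal_apply]
      by_cases hij : i = j
      · subst hij; simp
      · have : (j : ℕ) ≠ i := fun hh => hij (Fin.ext hh.symm)
        simp [hij, this]
    have hp : pT Ts = Polynomial.X ^ h := by
      simp only [hpT, hNT]
      rw [Matrix.diagonal_map (Polynomial.C_0), ← Matrix.diagonal_smul,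
        Matrix.diagonal_map (Polynomial.C_0), Matrix.diagonal_add, Matrix.det_diagonal,
        Fin.prod_univ_add]
      have h1 : ∀ i : Fin h, ((Polynomial.X : Polynomial F) • fun i => Polynomial.C (d 0 i))
          (Fin.castAdd h i) + Polynomial.C (d 1 (Fin.castAdd h i)) = Polynomial.X := by
        intro i; simp [hd, i.isLt]
      have h2 : ∀ i : Fin h, ((Polynomial.X : Polynomial F) • fun i => Polynomial.C (d 0 i))
          (Fin.natAdd h i) + Polynomial.C (d 1 (Fin.natAdd h i)) = 1 := by
        intro i; simp [hd]
      simp_rw [h1, h2]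
      simp
    intro hf0
    have h0 := heval Ts
    rw [hf0, map_zero, eval_zero_apolarW, hp] at h0
    simp_rw [Polynomial.coeff_X_pow] at h0
    rw [Finset.sum_eq_single h (fun i _ hi => by simp [hi]) (fun hh => absurd
      (Finset.mem_range.mpr (by omega)) hh)] at h0
    simp only [show h + h - h = h from Nat.add_sub_cancel h h, if_true, mul_one] at h0
    refine (mul_ne_zero (pow_ne_zero _ (neg_ne_zero.mpr one_ne_zero)) ?_) h0.symm
    exact_mod_cast (Nat.mul_ne_zero (Nat.factorial_ne_zero h) (Nat.factorial_ne_zero h))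
  · -- (3) homogeneous of degree `2m`
    have hPc : ∀ k, (P.coeff k).IsHomogeneous (h + h) := by
      intro k
      have := coeff_det_isHomogeneous M (fun i j k' => ?_) k
      · simpa using this
      simp only [hM, Matrix.add_apply, Matrix.smul_apply, Matrix.map_apply, Matrix.of_apply,
        smul_eq_mul, Polynomial.X_mul_C, Polynomial.C_mul_X_eq_monomial, Polynomial.coeff_add,
        Polynomial.coeff_monomial, Polynomial.coeff_C]
      by_cases h0 : k' = 0
      · subst h0; simpa using MvPolynomial.isHomogeneous_X F ((1 : Fin 2), i, ρ j)
      · by_cases h1 : k' = 1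
        · subst h1; simpa using MvPolynomial.isHomogeneous_X F ((0 : Fin 2), i, ρ j)
        · rw [if_neg (Ne.symm h1), if_neg h0, add_zero]
          exact MvPolynomial.isHomogeneous_zero _ _ _
    rw [hf]
    refine MvPolynomial.IsHomogeneous.sum _ _ _ fun i _ => ?_
    have := (MvPolynomial.isHomogeneous_C _ ((-1 : F) ^ i * ((h + h - i).factorial * i.factorial : ℕ))).mul
      ((hPc (h + h - i)).mul (hPc i))
    rwa [show 0 + (h + h + (h + h)) = 2 * (h + h) by ring] at this
  · -- (4) vanishing on `𝓜_r`
    rintro T ⟨x, hx, hrk⟩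
    rw [heval]
    have htr : (contract3 T x).submatrix id ρ = x 0 • N T 0 + x 1 • N T 1 := by
      ext i j
      simp [hN, contract3_apply, Fin.sum_univ_two, Matrix.add_apply]
    have hrk' : (x 0 • N T 0 + x 1 • N T 1).rank ≤ r := by
      rw [← htr]; exact (Matrix.rank_submatrix_le _ _ _).trans hrk
    by_cases hx1 : x 1 = 0
    · -- the root at infinity: `rk T₀ ≤ r`, so `deg p_T ≤ r`
      have hx0 : x 0 ≠ 0 := by
        intro h0; apply hx; funext a; fin_cases a <;> simp [h0, hx1]
      have hr0 : (N T 0).rank ≤ r := by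
        have : N T 0 = (x 0)⁻¹ • (x 0 • N T 0 + x 1 • N T 1) := by
          rw [hx1, zero_smul, add_zero, smul_smul, inv_mul_cancel₀ hx0, one_smul]
        rw [this]; exact (rank_smul_le _ _).trans hrk'
      exact eval_zero_apolarW_eq_zero_of_natDegree_le
        (natDegree_det_X_smul_add_le_of_rank_le (N T 0) (N T 1) hr0) hm
    · -- the root `a = x₀/x₁` of multiplicity `≥ m - r > m/2`
      set a : F := x 0 * (x 1)⁻¹ with ha
      have hr1 : (a • N T 0 + N T 1).rank ≤ r := by
        have : a • N T 0 + N T 1 = (x 1)⁻¹ • (x 0 • N T 0 + x 1 • N T 1) := by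
          rw [smul_add, smul_smul, smul_smul, inv_mul_cancel₀ hx1, one_smul, ha, mul_comm]
        rw [this]; exact (rank_smul_le _ _).trans hrk'
      have hdvd : (Polynomial.X : Polynomial F) ^ (h + h - r) ∣
          (pT T).comp (Polynomial.X + Polynomial.C a) := by
        have := X_pow_dvd_det_X_smul_add_of_rank_le (a • N T 0 + N T 1) (N T 0) hr1
        rw [Fintype.card_fin] at this
        simpa only [hpT, det_pencil_comp] using this
      exact eval_zero_apolarW_eq_zero_of_dvd (hdeg T) a hdvd (by omega)

end RankTwo

end BILPS2019

end Literature.Computability.AlgebraicComplexity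

end
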